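import Mathlib.Data.Nat.Choose.Bounds
import Mathlib.Algebra.Field.GeomSum
import Literature.NumberTheory.LFunctions.HermiteJensenCriterion
import Literature.NumberTheory.LFunctions.XiToeplitzCubicWedge
import HarnessLib

/-!
# The Turán certificate of O'Sullivan's Hermite–Jensen polynomials `P^{d,n}_γ`: the ratio lemma

C. O'Sullivan, *Zeros of Jensen polynomials and asymptotics for the Riemann xi function*, Res. Math.
Sci. 8 (2021) no. 46, introduces for a sequence `γ` the polynomials
`P^{d,n}_γ(X) = Σ_{j ≤ d} C(d,j) γ(n+j) 𝐇_{d-j}(X)` ((1.4); `𝐇_k` the Hermite polynomials with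
`Σ 𝐇_k tᵏ/k! = e^{2Xt - t²}`) and proves (Thm. 1.2) that the Riemann Hypothesis is equivalent to the
hyperbolicity of all `P^{d,n}_γ`, `γ = xiTaylorCoeff`; by (8.3) Turán's criterion for Hermite expansions
gives the sufficient condition `T_P(d,n) < 1`. In the tree's normalisation `gorzHermite k = 𝐇_k(X/2)`
(`JensenTuranCriterion.lean`, Turán's criterion `splits_hermiteSum_of_turan`):

* `hermiteJensenPoly γ d n = P^{d,n}_γ(X/2) = hermiteSum (k ↦ C(d,k) γ(n + (d-k))) d` is the tree's
  (`HermiteJensenCriterion.lean`, with O'Sullivan's Thm. 1.2 and Cor. 3.8);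
* `HermiteJensenCert γ d n` (typed by the rh-jensen THEORY seat, HOME/rh-jensen-theory/JensenTargets.lean §6) — Turán's certificate (the hypothesis of `splits_hermiteSum_of_turan`), which
  implies hyperbolicity with `d` simple zeros;
* **the ratio lemma** `hermiteJensenCert_of_ratio` (S-HJ1 of the cell's plan, PROVED here): for a positive
  log-concave `γ` and `d ≥ 2`, `d³γ(n+1)⁴ ≤ 8γ(n)⁴` implies the certificate — `γ(n+j) ≤ γ(n)ρʲ`,
  `ρ = γ(n+1)/γ(n)`, `C(d,j) ≤ dʲ/j!`, and with `x = dρ²/2 ≤ 1`, `dx² ≤ 2`: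
  `T ≤ d·Σ_{j≥2} xʲ/(j!)² ≤ dx²·(9/32) ≤ 9/16 < 1`;
* the threshold schema `HermiteJensenThreshold n₀` (`∀ d ≥ 2, n ≥ n₀` with `d³log⁸n ≤ 2¹⁹(n+½)⁴`,
  `P^{d,n}_ξ` hyperbolic) and its reduction `hermiteJensenThreshold_of_momentLaw` to the moment law
  `16·M_{2n+2} ≤ log²n·M_{2n}` (`n ≥ n₀`) — the latter is proved for `n₀ = 10⁵` in `XiMomentRatioLog.lean`,
  whence the kernel rung `HermiteJensenThreshold 100000` (`HermiteJensenThresholdK1.lean`).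

The log-concavity input for `γ = xiTaylorCoeff` is the tree's `xiTaylorCoeff_mul_le_sq` (Turán's
inequalities; in the tree from the kernel-certified hyperbolicity of `J^{2,n}_ξ`). Nothing here concerns
zeros of `ζ`; the `P`-row is cellwise weaker than the `J`-row (O'Sullivan Cor. 3.8).

## References
* [Osullivan2021] C. O'Sullivan, Res. Math. Sci. 8 (2021) 46 = arXiv:2007.13582, (1.4), (1.6), Thm. 1.2,
  Thm. 1.3, Cor. 3.8, (8.3).
* [GriffinEtAl2022] Griffin–Ono–Rolen–Thorner–Tripp–Wagner, Adv. Math. 397 (2022), Lemma 2.4 (Turán's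
  criterion for Hermite expansions).
-/

noncomputable section

open Polynomial Finset
open scoped Nat

namespace Literature.NumberTheory.LFunctions

/-! ### The certificate and the threshold schema -/

/-- **Turán's certificate for `P^{d,n}_γ`**: `Σ_{k ≤ d-2} 2ᵏ k!·b_k² < 2ᵈ (d-1)!·b_d²`, `b_d = γ(n)` — the
hypothesis of the tree's `splits_hermiteSum_of_turan`; for `γ > 0` it is O'Sullivan's `T_P(d,n) < 1`,
`T_P(d,n) = Σ_{j=2}^{d} d·C(d,j)/(2ʲj!)·(γ(n+j)/γ(n))²`. [cite: Osullivan2021, (8.3)] -/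
def HermiteJensenCert (γ : ℕ → ℝ) (d n : ℕ) : Prop :=
  ∑ k ∈ range (d - 1), 2 ^ k * (k ! : ℝ) * hermiteJensenCoeff γ d n k ^ 2 <
    2 ^ d * ((d - 1)! : ℝ) * hermiteJensenCoeff γ d n d ^ 2

/-- **The explicit Hermite–Jensen threshold law from shift `n₀`** (cell rh-jensen, target P4 schema):
for all `d ≥ 2` and `n ≥ n₀` with `d³·log⁸ n ≤ 2¹⁹·(n + ½)⁴` (i.e. `n + ½ ≥ 2^{-19/4} d^{3/4} log² n`;
O'Sullivan's Thm. 1.3 has `n/log²n ≥ d^{3/4}/2` for ineffective `d ≥ d₀`), `P^{d,n}_ξ` is hyperbolic.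
[cite: Osullivan2021, Thm. 1.3] -/
def HermiteJensenThreshold (n₀ : ℕ) : Prop :=
  ∀ d n : ℕ, 2 ≤ d → n₀ ≤ n → (d : ℝ) ^ 3 * Real.log n ^ 8 ≤ 2 ^ 19 * ((n : ℝ) + 1 / 2) ^ 4 →
    (hermiteJensenPoly xiTaylorCoeff d n).Splits

/-! ### Elementary facts -/

/-- The top coefficient is `b_d = γ(n)`. [cite: Osullivan2021, (1.4)] -/
theorem hermiteJensenCoeff_self (γ : ℕ → ℝ) (d n : ℕ) : hermiteJensenCoeff γ d n d = γ n := by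
  simp [hermiteJensenCoeff]

/-- **Certificate ⇒ hyperbolic** (Turán's criterion, tree). [cite: GriffinEtAl2022, Lemma 2.4] -/
theorem hermiteJensenPoly_splits_of_cert {γ : ℕ → ℝ} {d : ℕ} (hd : 2 ≤ d) (n : ℕ)
    (h : HermiteJensenCert γ d n) : (hermiteJensenPoly γ d n).Splits :=
  splits_hermiteSum_of_turan hd _ h

/-- **Certificate ⇒ exactly `d` simple real zeros.** [cite: GriffinEtAl2022, Lemma 2.4] -/
theorem hermiteJensenPoly_card_roots_of_cert {γ : ℕ → ℝ} {d : ℕ} (hd : 2 ≤ d) (n : ℕ)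
    (h : HermiteJensenCert γ d n) :
    (hermiteJensenPoly γ d n).roots.card = d ∧ (hermiteJensenPoly γ d n).roots.Nodup :=
  card_roots_hermiteSum_of_turan hd _ h

/-- The threshold law is monotone in its floor `n₀`. [cite: Osullivan2021, Thm. 1.3] -/
theorem hermiteJensenThreshold_mono {n₀ n₁ : ℕ} (h : n₀ ≤ n₁) :
    HermiteJensenThreshold n₀ → HermiteJensenThreshold n₁ :=
  fun H d n hd hn => H d n hd (h.trans hn)

/-! ### The ratio lemma (S-HJ1): `d³ρ⁴ ≤ 8` certifies `P^{d,n}_γ` for log-concave `γ > 0` -/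

/-- `(j!)² ≥ 4·9^{j-2}` for `j ≥ 2` (as `((i+2)!)² ≥ 4·9ⁱ`). [folklore] -/
private theorem four_mul_nine_pow_le_factorial_sq (i : ℕ) :
    (4 : ℝ) * 9 ^ i ≤ (((i + 2)! : ℕ) : ℝ) ^ 2 := by
  induction i with
  | zero => norm_num [Nat.factorial]
  | succ i ih =>
    rw [show i + 1 + 2 = (i + 2) + 1 by ring, Nat.factorial_succ, Nat.cast_mul, mul_pow, pow_succ]
    have h9 : (9 : ℝ) ≤ ((i + 2 + 1 : ℕ) : ℝ) ^ 2 := by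
      have : (3 : ℝ) ≤ ((i + 2 + 1 : ℕ) : ℝ) := by push_cast; linarith [(Nat.cast_nonneg i : (0:ℝ) ≤ i)]
      nlinarith
    have h0 : (0 : ℝ) ≤ 4 * 9 ^ i := by positivity
    nlinarith

/-- Log-concavity makes the ratios `γ(m+1)/γ(m)` non-increasing, hence `γ(n+j) ≤ γ(n)·ρʲ`,
`ρ = γ(n+1)/γ(n)`. [cite: Osullivan2021, (8.3)] -/
private theorem le_mul_ratio_pow {γ : ℕ → ℝ} (hpos : ∀ m, 0 < γ m)
    (hlc : ∀ m, γ m * γ (m + 2) ≤ γ (m + 1) ^ 2) (n : ℕ) :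
    ∀ j : ℕ, γ (n + j) ≤ γ n * (γ (n + 1) / γ n) ^ j := by
  -- the ratio at `n + j` is at most the ratio at `n`
  have hratio : ∀ j : ℕ, γ (n + j + 1) / γ (n + j) ≤ γ (n + 1) / γ n := by
    intro j
    induction j with
    | zero => simp
    | succ j ih =>
      have h1 : γ (n + (j + 1) + 1) / γ (n + (j + 1)) ≤ γ (n + j + 1) / γ (n + j) := by
        rw [div_le_div_iff₀ (hpos _) (hpos _)]
        have := hlc (n + j)
        rw [show n + (j + 1) + 1 = n + j + 2 by ring, show n + (j + 1) = n + j + 1 by ring]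
        nlinarith
      exact h1.trans ih
  intro j
  induction j with
  | zero => simp
  | succ j ih =>
    have h1 : γ (n + (j + 1)) = γ (n + j + 1) / γ (n + j) * γ (n + j) := by
      rw [show n + (j + 1) = n + j + 1 by ring]; field_simp [(hpos (n + j)).ne']
    rw [h1, pow_succ]
    have hr := hratio j
    have hρ0 : 0 ≤ γ (n + 1) / γ n := (div_pos (hpos _) (hpos _)).le
    calc γ (n + j + 1) / γ (n + j) * γ (n + j)
        ≤ (γ (n + 1) / γ n) * (γ n * (γ (n + 1) / γ n) ^ j) :=
          mul_le_mul hr ih (hpos _).le hρ0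
      _ = γ n * ((γ (n + 1) / γ n) ^ j * (γ (n + 1) / γ n)) := by ring

/-- **The ratio lemma (S-HJ1; RH-free and ξ-free).** For every positive log-concave sequence `γ` and
every `d ≥ 2`: `d³·γ(n+1)⁴ ≤ 8·γ(n)⁴` implies Turán's certificate for `P^{d,n}_γ`
(`T_P ≤ d·Σ_{j≥2}(dρ²/2)ʲ/(j!)² ≤ 9/16 < 1`). [cite: Osullivan2021, (8.3)] -/
theorem hermiteJensenCert_of_ratio {γ : ℕ → ℝ} (hpos : ∀ m, 0 < γ m)
    (hlc : ∀ m, γ m * γ (m + 2) ≤ γ (m + 1) ^ 2) {d : ℕ} (n : ℕ) (hd : 2 ≤ d)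
    (hρ : (d : ℝ) ^ 3 * γ (n + 1) ^ 4 ≤ 8 * γ n ^ 4) : HermiteJensenCert γ d n := by
  set ρ := γ (n + 1) / γ n with hρdef
  have hγn := hpos n
  have hρ0 : 0 < ρ := div_pos (hpos _) hγn
  have hd0 : (0 : ℝ) < d := by exact_mod_cast (lt_of_lt_of_le (by norm_num) hd : 0 < d)
  have hd2 : (2 : ℝ) ≤ d := by exact_mod_cast hd
  -- `d³ρ⁴ ≤ 8`, `x = dρ²/2 ≤ 1`, `d x² ≤ 2`
  have hρ4 : (d : ℝ) ^ 3 * ρ ^ 4 ≤ 8 := by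
    have e : ρ ^ 4 * γ n ^ 4 = γ (n + 1) ^ 4 := by
      rw [hρdef, div_pow, div_mul_cancel₀ _ (pow_ne_zero 4 hγn.ne')]
    have h4 : 0 < γ n ^ 4 := pow_pos hγn 4
    have key : (d : ℝ) ^ 3 * ρ ^ 4 * γ n ^ 4 ≤ 8 * γ n ^ 4 := by rw [mul_assoc, e]; exact hρ
    exact le_of_mul_le_mul_right key h4
  set x := (d : ℝ) * ρ ^ 2 / 2 with hx
  have hx0 : 0 ≤ x := by positivity
  have hdx2 : (d : ℝ) * x ^ 2 ≤ 2 := by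
    have : (d : ℝ) * x ^ 2 = (d : ℝ) ^ 3 * ρ ^ 4 / 4 := by rw [hx]; ring
    rw [this]; linarith
  have hx1 : x ≤ 1 := by
    have : x ^ 2 ≤ 1 := by nlinarith
    nlinarith
  have hxj : ∀ j : ℕ, 2 ≤ j → x ^ j ≤ x ^ 2 := fun j hj => pow_le_pow_of_le_one hx0 hx1 hj
  clear_value x ρ
  -- the per-term bound: for `k ≤ d - 2`, `j = d - k`,
  -- `2ᵏ k! b_k² ≤ γ(n)² · 2ᵈ d! · x² / 4 · (1/9)^{d-2-k}`
  have hterm : ∀ k ∈ range (d - 1), 2 ^ k * (k ! : ℝ) * hermiteJensenCoeff γ d n k ^ 2 ≤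
      γ n ^ 2 * (2 ^ d * (d ! : ℝ)) * (x ^ 2 / 4) * (1 / 9) ^ (d - 1 - 1 - k) := by
    intro k hk
    rw [mem_range] at hk
    set j := d - k with hj
    have hj2 : 2 ≤ j := by omega
    have hkd : k ≤ d := by omega
    have hkj : k = d - j := by omega
    have hjd : j ≤ d := by omega
    -- `b_k = C(d,k) γ(n+j) ≤ C(d,j) γ(n) ρ^j`
    have hchoose : (d.choose k : ℝ) = d.choose j := by
      rw [hkj, Nat.choose_symm hjd]
    have hb : hermiteJensenCoeff γ d n k ≤ (d.choose j : ℝ) * (γ n * ρ ^ j) := by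
      rw [hermiteJensenCoeff, hchoose, ← hj, hρdef]
      exact mul_le_mul_of_nonneg_left (le_mul_ratio_pow hpos hlc n j) (Nat.cast_nonneg _)
    have hb0 : 0 ≤ hermiteJensenCoeff γ d n k := by
      rw [hermiteJensenCoeff]; exact mul_nonneg (Nat.cast_nonneg _) (hpos _).le
    have hb2 : hermiteJensenCoeff γ d n k ^ 2 ≤ ((d.choose j : ℝ) * (γ n * ρ ^ j)) ^ 2 :=
      pow_le_pow_left₀ hb0 hb 2
    -- `k! C(d,j)² = C(d,j) · d!/j!` and `C(d,j) ≤ dʲ/j!`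
    have hfact : ((d.choose j : ℕ) : ℝ) * (j ! : ℝ) * (k ! : ℝ) = d ! := by
      rw [hkj]; exact_mod_cast Nat.choose_mul_factorial_mul_factorial hjd
    have hcle : (d.choose j : ℝ) ≤ (d : ℝ) ^ j / j ! := Nat.choose_le_pow_div j d
    have hjf : (0 : ℝ) < j ! := by positivity
    -- assemble: `2ᵏ k! (C γ(n) ρ^j)² = γ(n)² 2ᵏ (k! C) C ρ^{2j} = γ(n)² 2ᵏ (d!/j!) C ρ^{2j}`
    have hstep1 : 2 ^ k * (k ! : ℝ) * ((d.choose j : ℝ) * (γ n * ρ ^ j)) ^ 2 =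
        γ n ^ 2 * 2 ^ k * ((d ! : ℝ) / j !) * (d.choose j : ℝ) * ρ ^ (2 * j) := by
      have e : (k ! : ℝ) * (d.choose j : ℝ) = (d ! : ℝ) / j ! := by
        rw [eq_div_iff hjf.ne']; linarith [hfact]
      calc 2 ^ k * (k ! : ℝ) * ((d.choose j : ℝ) * (γ n * ρ ^ j)) ^ 2
          = γ n ^ 2 * 2 ^ k * ((k ! : ℝ) * (d.choose j : ℝ)) * (d.choose j : ℝ) * ρ ^ (2 * j) := by
            rw [pow_mul]; ring
        _ = _ := by rw [e]
    have hstep2 : γ n ^ 2 * 2 ^ k * ((d ! : ℝ) / j !) * (d.choose j : ℝ) * ρ ^ (2 * j) ≤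
        γ n ^ 2 * 2 ^ k * ((d ! : ℝ) / j !) * ((d : ℝ) ^ j / j !) * ρ ^ (2 * j) := by
      have h0 : 0 ≤ γ n ^ 2 * 2 ^ k * ((d ! : ℝ) / j !) := by positivity
      have h1 : 0 ≤ ρ ^ (2 * j) := by positivity
      calc γ n ^ 2 * 2 ^ k * ((d ! : ℝ) / j !) * (d.choose j : ℝ) * ρ ^ (2 * j)
          = (γ n ^ 2 * 2 ^ k * ((d ! : ℝ) / j !)) * ((d.choose j : ℝ) * ρ ^ (2 * j)) := by ring
        _ ≤ (γ n ^ 2 * 2 ^ k * ((d ! : ℝ) / j !)) * (((d : ℝ) ^ j / j !) * ρ ^ (2 * j)) :=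
            mul_le_mul_of_nonneg_left (mul_le_mul_of_nonneg_right hcle h1) h0
        _ = _ := by ring
    -- `2ᵏ (d!/j!) (dʲ/j!) ρ^{2j} = 2ᵈ d! xʲ/(j!)²` since `k = d - j`, `x = dρ²/2`
    have hstep3 : γ n ^ 2 * 2 ^ k * ((d ! : ℝ) / j !) * ((d : ℝ) ^ j / j !) * ρ ^ (2 * j) =
        γ n ^ 2 * (2 ^ d * (d ! : ℝ)) * (x ^ j / (j ! : ℝ) ^ 2) := by
      have h2 : (2 : ℝ) ^ d = 2 ^ k * 2 ^ j := by rw [← pow_add, show k + j = d by omega]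
      rw [h2, hx, div_pow, mul_pow, ← pow_mul]
      field_simp
    -- `xʲ/(j!)² ≤ x²/4 · (1/9)^{j-2}`
    have hstep4 : x ^ j / (j ! : ℝ) ^ 2 ≤ x ^ 2 / 4 * (1 / 9) ^ (d - 1 - 1 - k) := by
      have hi : d - 1 - 1 - k = j - 2 := by omega
      rw [hi]
      have hf := four_mul_nine_pow_le_factorial_sq (j - 2)
      rw [show j - 2 + 2 = j by omega] at hf
      have hf0 : (0 : ℝ) < ((j ! : ℕ) : ℝ) ^ 2 := by positivity
      rw [div_le_iff₀ hf0]
      have h9 : (0 : ℝ) < 9 ^ (j - 2) := by positivity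
      calc x ^ j ≤ x ^ 2 := hxj j hj2
        _ = x ^ 2 / 4 * (1 / 9) ^ (j - 2) * (4 * 9 ^ (j - 2)) := by
            rw [one_div, inv_pow]; field_simp
        _ ≤ x ^ 2 / 4 * (1 / 9) ^ (j - 2) * ((j ! : ℕ) : ℝ) ^ 2 :=
            mul_le_mul_of_nonneg_left hf (by positivity)
    calc 2 ^ k * (k ! : ℝ) * hermiteJensenCoeff γ d n k ^ 2
        ≤ 2 ^ k * (k ! : ℝ) * ((d.choose j : ℝ) * (γ n * ρ ^ j)) ^ 2 :=
          mul_le_mul_of_nonneg_left hb2 (by positivity)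
      _ = γ n ^ 2 * 2 ^ k * ((d ! : ℝ) / j !) * (d.choose j : ℝ) * ρ ^ (2 * j) := hstep1
      _ ≤ γ n ^ 2 * 2 ^ k * ((d ! : ℝ) / j !) * ((d : ℝ) ^ j / j !) * ρ ^ (2 * j) := hstep2
      _ = γ n ^ 2 * (2 ^ d * (d ! : ℝ)) * (x ^ j / (j ! : ℝ) ^ 2) := hstep3
      _ ≤ γ n ^ 2 * (2 ^ d * (d ! : ℝ)) * (x ^ 2 / 4 * (1 / 9) ^ (d - 1 - 1 - k)) :=
          mul_le_mul_of_nonneg_left hstep4 (by positivity)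
      _ = _ := by ring
  -- sum the geometric series
  have hgeom : ∑ k ∈ range (d - 1), (1 / 9 : ℝ) ^ (d - 1 - 1 - k) ≤ 9 / 8 := by
    rw [Finset.sum_range_reflect (fun i => (1 / 9 : ℝ) ^ i) (d - 1), geom_sum_eq (by norm_num) (d - 1)]
    have h0 : (0 : ℝ) ≤ (1 / 9) ^ (d - 1) := by positivity
    rw [div_le_iff_of_neg (by norm_num : (1 / 9 : ℝ) - 1 < 0)]
    linarith
  have hsum : ∑ k ∈ range (d - 1), 2 ^ k * (k ! : ℝ) * hermiteJensenCoeff γ d n k ^ 2 ≤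
      γ n ^ 2 * (2 ^ d * (d ! : ℝ)) * (x ^ 2 / 4) * (9 / 8) := by
    refine (Finset.sum_le_sum hterm).trans ?_
    rw [← Finset.mul_sum]
    exact mul_le_mul_of_nonneg_left hgeom (by positivity)
  -- `2ᵈ d! x² (9/32) ≤ 2ᵈ (d-1)! · (9/16)` by `d x² ≤ 2`, `d! = d (d-1)!`
  have hdfac : (d ! : ℝ) = d * ((d - 1)! : ℝ) := by
    obtain ⟨e, he⟩ : ∃ e, d = e + 1 := ⟨d - 1, by omega⟩
    subst he
    rw [Nat.factorial_succ, Nat.add_sub_cancel]; push_cast; ring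
  unfold HermiteJensenCert
  rw [hermiteJensenCoeff_self]
  have hpos2 : 0 < 2 ^ d * ((d - 1)! : ℝ) * γ n ^ 2 := by positivity
  calc ∑ k ∈ range (d - 1), 2 ^ k * (k ! : ℝ) * hermiteJensenCoeff γ d n k ^ 2
      ≤ γ n ^ 2 * (2 ^ d * (d ! : ℝ)) * (x ^ 2 / 4) * (9 / 8) := hsum
    _ = (2 ^ d * ((d - 1)! : ℝ) * γ n ^ 2) * ((9 / 32) * ((d : ℝ) * x ^ 2)) := by rw [hdfac]; ring
    _ ≤ (2 ^ d * ((d - 1)! : ℝ) * γ n ^ 2) * ((9 / 32) * 2) :=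
        mul_le_mul_of_nonneg_left (by nlinarith) hpos2.le
    _ < 2 ^ d * ((d - 1)! : ℝ) * γ n ^ 2 := by nlinarith

/-! ### The threshold law from the moment law -/

/-- **S-HJ2 ⇔ its moment form** at one shift: `16(n+½)γ(n+1) ≤ log²n·γ(n) ⇔ 16·M_{2n+2} ≤ log²n·M_{2n}`
(`γ(n) = 64·4ⁿn!/(2n)!·M_{2n}`). Bookkeeping typed by the rh-jensen theory seat. [cite: Osullivan2021, Thm. 1.3] -/
theorem xiCoeff_ratio_le_iff_moment (n : ℕ) :
    16 * ((n : ℝ) + 1 / 2) * xiTaylorCoeff (n + 1) ≤ Real.log n ^ 2 * xiTaylorCoeff n ↔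
      16 * xiMoment (2 * n + 2) ≤ Real.log n ^ 2 * xiMoment (2 * n) := by
  have e2 : 2 * (n + 1) = 2 * n + 2 := by ring
  have hf2 : (((2 * n + 2)! : ℕ) : ℝ) = (2 * n + 2) * (2 * n + 1) * ((2 * n)! : ℝ) := by
    rw [show 2 * n + 2 = (2 * n + 1) + 1 from rfl, Nat.factorial_succ, Nat.factorial_succ]
    push_cast; ring
  have hf1 : (((n + 1)! : ℕ) : ℝ) = (n + 1) * (n ! : ℝ) := by
    rw [Nat.factorial_succ]; push_cast; ring
  have hn0 : ((n ! : ℕ) : ℝ) ≠ 0 := by positivity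
  have h2n0 : (((2 * n)! : ℕ) : ℝ) ≠ 0 := by positivity
  set c : ℝ := 64 * 4 ^ n * (n ! : ℝ) / ((2 * n)! : ℝ) with hc_def
  have hc : 0 < c := by rw [hc_def]; positivity
  have eL : 16 * ((n : ℝ) + 1 / 2) * xiTaylorCoeff (n + 1) = c * (16 * xiMoment (2 * n + 2)) := by
    rw [xiTaylorCoeff_eq_xiMoment, e2, hf2, hf1, hc_def]
    field_simp
    ring
  have eR : Real.log n ^ 2 * xiTaylorCoeff n = c * (Real.log n ^ 2 * xiMoment (2 * n)) := by
    rw [xiTaylorCoeff_eq_xiMoment, hc_def]; ring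
  rw [eL, eR]
  exact ⟨fun h => le_of_mul_le_mul_left h hc, fun h => mul_le_mul_of_nonneg_left h hc.le⟩

/-- **P4's kernel route** (typed and kernel-checked by the rh-jensen theory seat): the ratio lemma plus
the moment law `16·M_{2n+2} ≤ log²n·M_{2n}` for `n ≥ n₀` give `HermiteJensenThreshold n₀`; uses `γ > 0`
(`xiTaylorCoeff_pos_holds`) and Turán's inequalities `γ(m)γ(m+2) ≤ γ(m+1)²` (`xiTaylorCoeff_mul_le_sq`).
[cite: Osullivan2021, Thm. 1.3] -/
theorem hermiteJensenThreshold_of_momentLaw {n₀ : ℕ}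
    (h2 : ∀ n : ℕ, n₀ ≤ n → 16 * xiMoment (2 * n + 2) ≤ Real.log n ^ 2 * xiMoment (2 * n)) :
    HermiteJensenThreshold n₀ := by
  intro d n hd hn hthr
  have hpos : ∀ m, 0 < xiTaylorCoeff m := xiTaylorCoeff_pos_holds
  refine hermiteJensenPoly_splits_of_cert hd n
    (hermiteJensenCert_of_ratio hpos xiTaylorCoeff_mul_le_sq n hd ?_)
  have hr := (xiCoeff_ratio_le_iff_moment n).2 (h2 n hn)
  have hγ1 := hpos (n + 1)
  have h16 : 0 ≤ 16 * ((n : ℝ) + 1 / 2) * xiTaylorCoeff (n + 1) :=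
    mul_nonneg (by positivity) hγ1.le
  have h4 : (16 * ((n : ℝ) + 1 / 2) * xiTaylorCoeff (n + 1)) ^ 4 ≤
      (Real.log n ^ 2 * xiTaylorCoeff n) ^ 4 := pow_le_pow_left₀ h16 hr 4
  have key : (d : ℝ) ^ 3 * xiTaylorCoeff (n + 1) ^ 4 * (2 ^ 16 * ((n : ℝ) + 1 / 2) ^ 4) ≤
      8 * xiTaylorCoeff n ^ 4 * (2 ^ 16 * ((n : ℝ) + 1 / 2) ^ 4) :=
    calc (d : ℝ) ^ 3 * xiTaylorCoeff (n + 1) ^ 4 * (2 ^ 16 * ((n : ℝ) + 1 / 2) ^ 4)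
        = (d : ℝ) ^ 3 * (16 * ((n : ℝ) + 1 / 2) * xiTaylorCoeff (n + 1)) ^ 4 := by ring
      _ ≤ (d : ℝ) ^ 3 * (Real.log n ^ 2 * xiTaylorCoeff n) ^ 4 :=
        mul_le_mul_of_nonneg_left h4 (by positivity)
      _ = ((d : ℝ) ^ 3 * Real.log n ^ 8) * xiTaylorCoeff n ^ 4 := by ring
      _ ≤ (2 ^ 19 * ((n : ℝ) + 1 / 2) ^ 4) * xiTaylorCoeff n ^ 4 :=
        mul_le_mul_of_nonneg_right hthr (by positivity)
      _ = 8 * xiTaylorCoeff n ^ 4 * (2 ^ 16 * ((n : ℝ) + 1 / 2) ^ 4) := by ring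
  exact le_of_mul_le_mul_right key (by positivity)

end Literature.NumberTheory.LFunctions
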